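import Literature.Probability.Percolation.QuadCrossingContinuityEventsProofs
import Literature.Probability.Percolation.QuadCrossingContinuityReduction
import Literature.Probability.Percolation.QuadCrossingPerturbations
import Literature.Probability.Percolation.QuadCrossingRawClosed
import Literature.Probability.Percolation.QuadCrossingNoiseDiscrete
import HarnessLib

/-!
# Schramm–Smirnov's (5.1) and Lemma 5.1 from the scale-free form of Lemma 6.1

Topic `Probability/Percolation`; proofs file next to `QuadCrossingContinuityReduction.lean` (whose
`SchrammSmirnov2011_lemma_6_1_of_bound` isolates the percolation content of Schramm–Smirnov's
continuity Lemma 6.1 as a SCALE-FREE bound `μ_η(⊞_Q Δ ⊞_{Q'}) ≤ F(δ / d(Q))`, `F → 0` at `0⁺`),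
and `QuadCrossingContinuityEventsProofs.lean` (`SchrammSmirnov2011_lemma_5_1_of_continuity`:
Lemma 5.1 from the discrete estimate (5.1)); consumed by the sibling
`QuadCrossingRotationInvarianceOfBound.lean` (DKKMO's Corollary 1.3 at `q = 1` from DKKMO's
Theorem 2.1 per quad and the same bound, through `dkkmo_crossing_rotation_invariance_of_thm21`).

O. Schramm, S. Smirnov, *On the scaling limits of planar percolation*, Ann. Probab. 39 (2011),
arXiv:1101.5820 (held, read at the page: proof of Lemma 5.1, §5 p. 21 of the arXiv version):

> "there is a continuous injective `Q̂₀ : [-1,2]² → D` whose restriction to `[0,1]²` is `Q₀`. Let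
> `M := [-1,1/3]² × [2/3,2]²`. For every quadruple `q = (x₀,y₀,x₁,y₁) ∈ M`, define the quad
> `Q^q(x,y) := Q̂₀(x₀+(x₁-x₀)x, y₀+(y₁-y₀)y)`. … Lemma 6.1 implies that there is some positive
> `δ₀ > 0` (depending on `Q̂₀`), such that if `q` and `q'` are in `M` and differ in exactly one
> coordinate, and the difference in that coordinate is at most `δ₀`, then
> `limsup_η μ_η(⊞_{Q^q} Δ ⊞_{Q^{q'}}) < ε`. Consequently `limsup_η μ_η(⊞_{Q^q} Δ ⊞_{Q^{q'}}) < 4ε`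
> provided `‖q - q'‖_∞ ≤ δ₀`. Set `q_s := (-s,s,1+s,1-s)`, `Q' := Q^{q_{-δ₀/2}}` and
> `Q'' := Q^{q_{δ₀/2}}`. Then `Q' < Q₀ < Q''` and `limsup_η μ_η(⊞_{Q'} Δ ⊞_{Q''}) < 4ε`."  (5.1)

**What is proved here.** The step "Lemma 6.1 implies (5.1)" — with one correction of the
book-keeping that the printed sentence glosses over.  Along the chain of four one-coordinate moves
from `Q'` to `Q''` the LARGER quad of each comparison (the `Q` of Lemma 6.1, whose size parameter
`d(Q)` enters `Δ_c(δ, d)`) varies with `s`; the rendered statement of Lemma 6.1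
(`SchrammSmirnov2011_lemma_6_1`: "`Δ_c(δ, d) → 0` as `δ → 0` for each fixed `d`", no monotonicity in
`d`) therefore does not yield (5.1) by itself ("`δ₀` depending on `Q̂₀`" silently uses that the RSW
function `Δ₁(δ, d)` is monotone in `d`).  The scale-free bound of
`SchrammSmirnov2011_lemma_6_1_of_bound` — the form the printed proof of Lemma 6.1 actually
delivers, `Δ₁` being a function of `r/R` — does: the size parameters of all four larger quads are
bounded below by the positive distance `m(Q̂₀)` between `Q̂₀({x ≤ -1/2})` and `Q̂₀({x ≥ 1/2})`, so a
perturbation size `ρ = ρ(ε, Q̂₀)` can be fixed FIRST (with `F(ρ/d) < ε` whenever `d ≥ m`) and the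
coordinate moves are then made `ρ`-short by uniform continuity of `Q̂₀`.  Results:

* `Quad.continuity_of_bound` — **(5.1) for critical bond percolation on `δℤ²`, every open `D ⊆ ℂ`
  and every `Q₀ ∈ 𝒬_D`**, in the raw form consumed by `SchrammSmirnov2011_lemma_5_1_of_continuity`
  and `dkkmo_crossing_rotation_invariance_of_thm21`: for every `ε > 0` there are `Q' < Q₀ < Q''`
  and `δ₀ > 0` with `P_{1/2}[Q' crossed inside the open edges of δℤ² ∧ Q'' not crossed] ≤ ε` for
  `0 < δ < δ₀`; hypothesis = the bound of `SchrammSmirnov2011_lemma_6_1_of_bound` for the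
  conditions (2), (3) of Lemma 6.1 only;
* `Quad.continuity_of_uniform`, `SchrammSmirnov2011_lemma_5_1_of_uniform` — the same from the
  weakest input the argument uses: UNIFORM smallness of `μ_η(⊞_Q Δ ⊞_{Q'})` over all quads `Q`
  with `d₀(Q) ≥ m` and their `ρ`-perturbations of type (2)/(3), `ρ ≤ ρ₀(m, ε)` (fed by the
  scale-free bound, `Quad.uniform_of_bound`, or by per-case power laws in `ρ/d₀(Q)`);
* `SchrammSmirnov2011_lemma_5_1_of_bound` — **Lemma 5.1 from that bound** (all open `D`);
* both also with the verbatim (three-condition) hypothesis of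
  `SchrammSmirnov2011_lemma_6_1_of_bound` (`…_of_bound'`): the bound that gives Lemma 6.1 through
  that reduction gives Lemma 5.1 through this one.

Infrastructure (all proved, chart-style as in `Quad.exists_perturbations`): quads presented as
`Q = H ∘ rectChart x₀ x₁ y₀ y₁` for a plane homeomorphism `H` and a possibly REVERSED coordinate
rectangle (`rectChart`, the one definition of the file); their carrier and sides; the reversed
presentation `(x₁, x₀, y₁, y₀)` has the same crossings; sub-rectangles give quads of `D`;
conditions (2)/(3) of Lemma 6.1 for a one-coordinate move of side `2`/`3`; a uniform positive
lower bound for `d(Q)`; and the push-forward identity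
`P_{1/2}({Q crossed} Δ {Q' crossed}) = μ_{δ/√2}(⊞_Q Δ ⊞_{Q'})` (`measurable_z2QuadConfig`).
No named fact is introduced; no percolation estimate is proved here (the bound is a hypothesis —
it is the target of the Lemma 6.1 proofs files, cf. `QuadCrossingContinuityCaseTwoSmall.lean`).

## References

* O. Schramm, S. Smirnov, Ann. Probab. 39 (2011) 1768–1814, arXiv:1101.5820: Lemma 5.1 and its
  proof (§5, p. 21), eq. (5.1); Lemma 6.1 (§6, p. 22). [SchrammSmirnov2011]
-/

noncomputable section

open Set Filter Metric
open _root_.Topology _root_.MeasureTheory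
open scoped unitInterval ENNReal
open Literature.Probability.LatticeModels

namespace Literature.Probability.Percolation

namespace QuadCrossing

namespace Quad

variable {D : Set ℂ}

/-! ### Elementary real lemmas on unordered intervals -/

/-- A convex combination `a + (b - a)s`, `s ∈ [0,1]`, lies in `[[a, b]]`. [folklore] -/
theorem affine_mem_uIcc (a b : ℝ) (s : I) : a + (b - a) * (s : ℝ) ∈ uIcc a b := by
  have hs0 : (0 : ℝ) ≤ s := s.2.1
  have hs1 : (s : ℝ) ≤ 1 := s.2.2
  rcases le_total a b with hab | hab
  · rw [uIcc_of_le hab]; constructor <;> nlinarith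
  · rw [uIcc_of_ge hab]; constructor <;> nlinarith

/-- Every point of `[[a, b]]`, `a ≠ b`, is a convex combination `a + (b - a)s` with `s ∈ [0,1]`.
[folklore] -/
theorem exists_affine_eq_of_mem_uIcc {a b u : ℝ} (hab : a ≠ b) (hu : u ∈ uIcc a b) :
    ∃ s : I, a + (b - a) * (s : ℝ) = u := by
  have hba : b - a ≠ 0 := sub_ne_zero.2 (Ne.symm hab)
  refine ⟨⟨(u - a) / (b - a), ?_, ?_⟩, ?_⟩
  · rcases lt_or_gt_of_ne hab with h | h
    · rw [uIcc_of_le h.le] at hu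
      exact div_nonneg (by linarith [hu.1]) (by linarith)
    · rw [uIcc_of_ge h.le] at hu
      exact div_nonneg_of_nonpos (by linarith [hu.2]) (by linarith)
  · rcases lt_or_gt_of_ne hab with h | h
    · rw [uIcc_of_le h.le] at hu
      rw [div_le_one (by linarith)]; linarith [hu.2]
    · rw [uIcc_of_ge h.le] at hu
      rw [div_le_one_of_neg (by linarith)]; linarith [hu.1]
  · simp only
    field_simp
    ring

/-- Two points of `[[a, b]]` are at distance at most `|a - b|`. [folklore] -/
theorem abs_sub_le_of_mem_uIcc {a b u u' : ℝ} (hu : u ∈ uIcc a b) (hu' : u' ∈ uIcc a b) :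
    |u - u'| ≤ |a - b| := by
  rcases le_total a b with hab | hab
  · rw [uIcc_of_le hab] at hu hu'
    rw [abs_sub_comm a b, abs_of_nonneg (sub_nonneg.2 hab), abs_sub_le_iff]
    constructor <;> linarith [hu.1, hu.2, hu'.1, hu'.2]
  · rw [uIcc_of_ge hab] at hu hu'
    rw [abs_of_nonneg (sub_nonneg.2 hab), abs_sub_le_iff]
    constructor <;> linarith [hu.1, hu.2, hu'.1, hu'.2]

/-! ### Rectangle charts -/

/-- **The affine chart of the unit square onto a coordinate rectangle**, possibly reversed:
`(x, y) ↦ (x₀ + (x₁ - x₀)x) + (y₀ + (y₁ - y₀)y) i`, so that `(0,0) ↦ x₀ + y₀ i` and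
`(1,1) ↦ x₁ + y₁ i` (Schramm–Smirnov's `Q^q`, `q = (x₀, y₀, x₁, y₁)`, read in the straightening
chart; we allow `x₁ < x₀` or `y₁ < y₀`, which relabels the sides).
[cite: SchrammSmirnov2011, proof of Lemma 5.1] -/
def rectChart (x₀ x₁ y₀ y₁ : ℝ) (p : I × I) : ℂ :=
  ((x₀ + (x₁ - x₀) * (p.1 : ℝ) : ℝ) : ℂ) + ((y₀ + (y₁ - y₀) * (p.2 : ℝ) : ℝ) : ℂ) * Complex.I

/-- Real and imaginary parts of the chart point. [folklore] -/
theorem rectChart_re_im (x₀ x₁ y₀ y₁ : ℝ) (p : I × I) :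
    (rectChart x₀ x₁ y₀ y₁ p).re = x₀ + (x₁ - x₀) * (p.1 : ℝ) ∧
      (rectChart x₀ x₁ y₀ y₁ p).im = y₀ + (y₁ - y₀) * (p.2 : ℝ) :=
  re_im_ofReal_add_ofReal_mul_I _ _

/-- The chart is continuous. [folklore] -/
theorem continuous_rectChart (x₀ x₁ y₀ y₁ : ℝ) : Continuous (rectChart x₀ x₁ y₀ y₁) := by
  unfold rectChart; fun_prop

/-- The chart is injective when the rectangle is non-degenerate. [folklore] -/
theorem rectChart_injective {x₀ x₁ y₀ y₁ : ℝ} (hx : x₀ ≠ x₁) (hy : y₀ ≠ y₁) :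
    Function.Injective (rectChart x₀ x₁ y₀ y₁) := by
  intro p q h
  have h' := ofReal_add_ofReal_mul_I_inj h
  have hx' : x₁ - x₀ ≠ 0 := sub_ne_zero.2 (Ne.symm hx)
  have hy' : y₁ - y₀ ≠ 0 := sub_ne_zero.2 (Ne.symm hy)
  have h1 : (p.1 : ℝ) = q.1 := mul_left_cancel₀ hx' (by linarith [h'.1])
  have h2 : (p.2 : ℝ) = q.2 := mul_left_cancel₀ hy' (by linarith [h'.2])
  exact Prod.ext (Subtype.ext h1) (Subtype.ext h2)

/-- The chart maps the square onto the closed coordinate rectangle `[[x₀, x₁]] × [[y₀, y₁]]`.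
[folklore] -/
theorem range_rectChart {x₀ x₁ y₀ y₁ : ℝ} (hx : x₀ ≠ x₁) (hy : y₀ ≠ y₁) :
    range (rectChart x₀ x₁ y₀ y₁) = uIcc x₀ x₁ ×ℂ uIcc y₀ y₁ := by
  ext z
  constructor
  · rintro ⟨p, rfl⟩
    rw [Complex.mem_reProdIm, (rectChart_re_im _ _ _ _ p).1, (rectChart_re_im _ _ _ _ p).2]
    exact ⟨affine_mem_uIcc _ _ _, affine_mem_uIcc _ _ _⟩
  · intro hz
    rw [Complex.mem_reProdIm] at hz
    obtain ⟨s, hs⟩ := exists_affine_eq_of_mem_uIcc hx hz.1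
    obtain ⟨s', hs'⟩ := exists_affine_eq_of_mem_uIcc hy hz.2
    refine ⟨(s, s'), Complex.ext ?_ ?_⟩
    · rw [(rectChart_re_im _ _ _ _ _).1]; exact hs
    · rw [(rectChart_re_im _ _ _ _ _).2]; exact hs'

/-- The image of the left edge `{x = 0}` is `{x₀} × [[y₀, y₁]]`. [folklore] -/
theorem image_rectChart_fst_eq_zero {x₀ x₁ y₀ y₁ : ℝ} (hy : y₀ ≠ y₁) :
    rectChart x₀ x₁ y₀ y₁ '' {z : I × I | z.1 = 0} = {(x₀ : ℝ)} ×ℂ uIcc y₀ y₁ := by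
  ext z
  constructor
  · rintro ⟨p, hp, rfl⟩
    have hp' : (p.1 : ℝ) = 0 := by rw [show p.1 = 0 from hp]; rfl
    rw [Complex.mem_reProdIm, (rectChart_re_im _ _ _ _ p).1, (rectChart_re_im _ _ _ _ p).2, hp',
      mul_zero, add_zero]
    exact ⟨rfl, affine_mem_uIcc _ _ _⟩
  · intro hz
    rw [Complex.mem_reProdIm, mem_singleton_iff] at hz
    obtain ⟨s', hs'⟩ := exists_affine_eq_of_mem_uIcc hy hz.2
    refine ⟨(0, s'), rfl, Complex.ext ?_ ?_⟩
    · rw [(rectChart_re_im _ _ _ _ _).1, hz.1]; simp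
    · rw [(rectChart_re_im _ _ _ _ _).2]; exact hs'

/-- The image of the right edge `{x = 1}` is `{x₁} × [[y₀, y₁]]`. [folklore] -/
theorem image_rectChart_fst_eq_one {x₀ x₁ y₀ y₁ : ℝ} (hy : y₀ ≠ y₁) :
    rectChart x₀ x₁ y₀ y₁ '' {z : I × I | z.1 = 1} = {(x₁ : ℝ)} ×ℂ uIcc y₀ y₁ := by
  ext z
  constructor
  · rintro ⟨p, hp, rfl⟩
    have hp' : (p.1 : ℝ) = 1 := by rw [show p.1 = 1 from hp]; rfl
    rw [Complex.mem_reProdIm, (rectChart_re_im _ _ _ _ p).1, (rectChart_re_im _ _ _ _ p).2, hp',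
      mul_one, add_sub_cancel]
    exact ⟨rfl, affine_mem_uIcc _ _ _⟩
  · intro hz
    rw [Complex.mem_reProdIm, mem_singleton_iff] at hz
    obtain ⟨s', hs'⟩ := exists_affine_eq_of_mem_uIcc hy hz.2
    refine ⟨(1, s'), rfl, Complex.ext ?_ ?_⟩
    · rw [(rectChart_re_im _ _ _ _ _).1, hz.1]; simp
    · rw [(rectChart_re_im _ _ _ _ _).2]; exact hs'

/-- The image of the bottom edge `{y = 0}` is `[[x₀, x₁]] × {y₀}`. [folklore] -/
theorem image_rectChart_snd_eq_zero {x₀ x₁ y₀ y₁ : ℝ} (hx : x₀ ≠ x₁) :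
    rectChart x₀ x₁ y₀ y₁ '' {z : I × I | z.2 = 0} = uIcc x₀ x₁ ×ℂ {(y₀ : ℝ)} := by
  ext z
  constructor
  · rintro ⟨p, hp, rfl⟩
    have hp' : (p.2 : ℝ) = 0 := by rw [show p.2 = 0 from hp]; rfl
    rw [Complex.mem_reProdIm, (rectChart_re_im _ _ _ _ p).1, (rectChart_re_im _ _ _ _ p).2, hp',
      mul_zero, add_zero]
    exact ⟨affine_mem_uIcc _ _ _, rfl⟩
  · intro hz
    rw [Complex.mem_reProdIm, mem_singleton_iff] at hz
    obtain ⟨s, hs⟩ := exists_affine_eq_of_mem_uIcc hx hz.1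
    refine ⟨(s, 0), rfl, Complex.ext ?_ ?_⟩
    · rw [(rectChart_re_im _ _ _ _ _).1]; exact hs
    · rw [(rectChart_re_im _ _ _ _ _).2, hz.2]; simp

/-- The image of the top edge `{y = 1}` is `[[x₀, x₁]] × {y₁}`. [folklore] -/
theorem image_rectChart_snd_eq_one {x₀ x₁ y₀ y₁ : ℝ} (hx : x₀ ≠ x₁) :
    rectChart x₀ x₁ y₀ y₁ '' {z : I × I | z.2 = 1} = uIcc x₀ x₁ ×ℂ {(y₁ : ℝ)} := by
  ext z
  constructor
  · rintro ⟨p, hp, rfl⟩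
    have hp' : (p.2 : ℝ) = 1 := by rw [show p.2 = 1 from hp]; rfl
    rw [Complex.mem_reProdIm, (rectChart_re_im _ _ _ _ p).1, (rectChart_re_im _ _ _ _ p).2, hp',
      mul_one, add_sub_cancel]
    exact ⟨affine_mem_uIcc _ _ _, rfl⟩
  · intro hz
    rw [Complex.mem_reProdIm, mem_singleton_iff] at hz
    obtain ⟨s, hs⟩ := exists_affine_eq_of_mem_uIcc hx hz.1
    refine ⟨(s, 1), rfl, Complex.ext ?_ ?_⟩
    · rw [(rectChart_re_im _ _ _ _ _).1]; exact hs
    · rw [(rectChart_re_im _ _ _ _ _).2, hz.2]; simp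

/-! ### Quads presented by a rectangle chart through a plane homeomorphism -/

/-- **A chart rectangle inside `D` is a quad of `D`**: if `H` maps `[[x₀,x₁]] × [[y₀,y₁]]` into `D`
(`x₀ ≠ x₁`, `y₀ ≠ y₁`), there is `Q ∈ 𝒬_D` with `Q = H ∘ rectChart x₀ x₁ y₀ y₁` — Schramm–Smirnov's
`Q^q`. [cite: SchrammSmirnov2011, proof of Lemma 5.1] -/
theorem exists_quad_of_chart (H : ℂ ≃ₜ ℂ) {x₀ x₁ y₀ y₁ : ℝ} (hx : x₀ ≠ x₁) (hy : y₀ ≠ y₁)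
    (hD : ∀ z ∈ uIcc x₀ x₁ ×ℂ uIcc y₀ y₁, H z ∈ D) :
    ∃ Q : Quad D, ∀ p, Q p = H (rectChart x₀ x₁ y₀ y₁ p) := by
  refine ⟨⟨fun p => H (rectChart x₀ x₁ y₀ y₁ p), H.continuous.comp (continuous_rectChart _ _ _ _),
    H.injective.comp (rectChart_injective hx hy), ?_⟩, fun p => rfl⟩
  rintro _ ⟨p, rfl⟩
  exact hD _ (by rw [← range_rectChart hx hy]; exact mem_range_self p)

section Chart

variable {H : ℂ ≃ₜ ℂ} {x₀ x₁ y₀ y₁ : ℝ} {Q : Quad D}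

/-- The carrier of a chart quad is the `H`-image of the coordinate rectangle. [folklore] -/
theorem carrier_eq_of_chart (hQ : ∀ p, Q p = H (rectChart x₀ x₁ y₀ y₁ p)) (hx : x₀ ≠ x₁)
    (hy : y₀ ≠ y₁) : Q.carrier = H '' (uIcc x₀ x₁ ×ℂ uIcc y₀ y₁) := by
  rw [← range_rectChart hx hy, ← range_comp]
  exact congrArg range (funext hQ)

/-- The coordinate rectangle of a chart quad is mapped into `D`. [folklore] -/
theorem mapsTo_of_chart (hQ : ∀ p, Q p = H (rectChart x₀ x₁ y₀ y₁ p)) (hx : x₀ ≠ x₁)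
    (hy : y₀ ≠ y₁) : ∀ z ∈ uIcc x₀ x₁ ×ℂ uIcc y₀ y₁, H z ∈ D := fun z hz =>
  Q.carrier_subset (by rw [carrier_eq_of_chart hQ hx hy]; exact mem_image_of_mem _ hz)

/-- Side `0` of a chart quad: `H({x₀} × [[y₀, y₁]])`. [folklore] -/
theorem side_zero_eq_of_chart (hQ : ∀ p, Q p = H (rectChart x₀ x₁ y₀ y₁ p)) (hy : y₀ ≠ y₁) :
    Q.side 0 = H '' ({(x₀ : ℝ)} ×ℂ uIcc y₀ y₁) := by
  show Q '' {z | z.1 = 0} = _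
  rw [show (Q : I × I → ℂ) = H ∘ rectChart x₀ x₁ y₀ y₁ from funext hQ, image_comp,
    image_rectChart_fst_eq_zero hy]

/-- Side `2` of a chart quad: `H({x₁} × [[y₀, y₁]])`. [folklore] -/
theorem side_two_eq_of_chart (hQ : ∀ p, Q p = H (rectChart x₀ x₁ y₀ y₁ p)) (hy : y₀ ≠ y₁) :
    Q.side 2 = H '' ({(x₁ : ℝ)} ×ℂ uIcc y₀ y₁) := by
  show Q '' {z | z.1 = 1} = _
  rw [show (Q : I × I → ℂ) = H ∘ rectChart x₀ x₁ y₀ y₁ from funext hQ, image_comp,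
    image_rectChart_fst_eq_one hy]

/-- Side `1` of a chart quad: `H([[x₀, x₁]] × {y₀})`. [folklore] -/
theorem side_one_eq_of_chart (hQ : ∀ p, Q p = H (rectChart x₀ x₁ y₀ y₁ p)) (hx : x₀ ≠ x₁) :
    Q.side 1 = H '' (uIcc x₀ x₁ ×ℂ {(y₀ : ℝ)}) := by
  show Q '' {z | z.2 = 0} = _
  rw [show (Q : I × I → ℂ) = H ∘ rectChart x₀ x₁ y₀ y₁ from funext hQ, image_comp,
    image_rectChart_snd_eq_zero hx]

/-- Side `3` of a chart quad: `H([[x₀, x₁]] × {y₁})`. [folklore] -/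
theorem side_three_eq_of_chart (hQ : ∀ p, Q p = H (rectChart x₀ x₁ y₀ y₁ p)) (hx : x₀ ≠ x₁) :
    Q.side 3 = H '' (uIcc x₀ x₁ ×ℂ {(y₁ : ℝ)}) := by
  show Q '' {z | z.2 = 1} = _
  rw [show (Q : I × I → ℂ) = H ∘ rectChart x₀ x₁ y₀ y₁ from funext hQ, image_comp,
    image_rectChart_snd_eq_one hx]

/-- **The reversed chart has the same crossings**: the quads `H ∘ rectChart x₀ x₁ y₀ y₁` and
`H ∘ rectChart x₁ x₀ y₁ y₀` (the latter is the former precomposed with `(x,y) ↦ (1-x, 1-y)`: same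
carrier, sides `0 ↔ 2`, `1 ↔ 3`) are crossed by the same continua. [cite: SchrammSmirnov2011, §1.3] -/
theorem isCrossing_iff_of_chart_rev {Q' : Quad D} (hQ : ∀ p, Q p = H (rectChart x₀ x₁ y₀ y₁ p))
    (hQ' : ∀ p, Q' p = H (rectChart x₁ x₀ y₁ y₀ p)) (hx : x₀ ≠ x₁) (hy : y₀ ≠ y₁) (K : Set ℂ) :
    Q'.IsCrossing K ↔ Q.IsCrossing K := by
  unfold IsCrossing
  rw [carrier_eq_of_chart hQ hx hy, carrier_eq_of_chart hQ' hx.symm hy.symm,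
    side_zero_eq_of_chart hQ hy, side_two_eq_of_chart hQ hy, side_zero_eq_of_chart hQ' hy.symm,
    side_two_eq_of_chart hQ' hy.symm, uIcc_comm x₁ x₀, uIcc_comm y₁ y₀]
  tauto

/-- A sub-rectangle (in either orientation) of the chart rectangle of a quad of `D` is again the
chart of a quad of `D`. [cite: SchrammSmirnov2011, proof of Lemma 5.1] -/
theorem exists_quad_of_chart_sub (hQ : ∀ p, Q p = H (rectChart x₀ x₁ y₀ y₁ p)) (hx : x₀ ≠ x₁)
    (hy : y₀ ≠ y₁) {u₀ u₁ v₀ v₁ : ℝ} (hu₀ : u₀ ∈ uIcc x₀ x₁) (hu₁ : u₁ ∈ uIcc x₀ x₁)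
    (hv₀ : v₀ ∈ uIcc y₀ y₁) (hv₁ : v₁ ∈ uIcc y₀ y₁) (hu : u₀ ≠ u₁) (hv : v₀ ≠ v₁) :
    ∃ Q' : Quad D, ∀ p, Q' p = H (rectChart u₀ u₁ v₀ v₁ p) := by
  refine exists_quad_of_chart H hu hv fun z hz => mapsTo_of_chart hQ hx hy z ?_
  rw [Complex.mem_reProdIm] at hz ⊢
  exact ⟨uIcc_subset_uIcc hu₀ hu₁ hz.1, uIcc_subset_uIcc hv₀ hv₁ hz.2⟩

end Chart

/-! ### Conditions (2) and (3) of Lemma 6.1 for one-coordinate moves of a chart rectangle -/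

section Moves

variable {H : ℂ ≃ₜ ℂ} {x₀ x₁ y₀ y₁ : ℝ} {Q Q' : Quad D}

/-- **Condition (2) of Lemma 6.1 for a move of side `2`.** Let `Q = H ∘ rectChart x₀ x₁ y₀ y₁` and
`Q' = H ∘ rectChart x₀ x₁' y₀ y₁` with `x₁' ∈ [[x₀, x₁]]` (so `[Q'] ⊆ [Q]`, `∂₀Q' = ∂₀Q`,
`∂₁Q' ⊆ ∂₁Q`, `∂₃Q' ⊆ ∂₃Q`), all coordinates in `[-2, 2]`, and suppose `H` moves points of
`[-2,2]²` at distance `≤ |x₁ - x₁'|` to points at distance `≤ ρ`.  Then every point `H(x₁' + vi)`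
of `∂₂Q'` is joined to `H(x₁ + vi) ∈ ∂₂Q` by the `H`-image of the horizontal segment, a path in
`[Q]` of diameter `≤ ρ`: `Q.IsPerturbationTwo Q' ρ`. [cite: SchrammSmirnov2011, Lemma 6.1 (2)] -/
theorem isPerturbationTwo_of_chart {x₁' ρ : ℝ} (hQ : ∀ p, Q p = H (rectChart x₀ x₁ y₀ y₁ p))
    (hQ' : ∀ p, Q' p = H (rectChart x₀ x₁' y₀ y₁ p)) (hx : x₀ ≠ x₁) (hx' : x₀ ≠ x₁')
    (hy : y₀ ≠ y₁) (hmem : x₁' ∈ uIcc x₀ x₁) (hx₀C : x₀ ∈ Icc (-2 : ℝ) 2)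
    (hx₁C : x₁ ∈ Icc (-2 : ℝ) 2) (hy₀C : y₀ ∈ Icc (-2 : ℝ) 2) (hy₁C : y₁ ∈ Icc (-2 : ℝ) 2)
    (hρ : 0 ≤ ρ)
    (hH : ∀ z ∈ (Icc (-2 : ℝ) 2 ×ℂ Icc (-2 : ℝ) 2), ∀ w ∈ (Icc (-2 : ℝ) 2 ×ℂ Icc (-2 : ℝ) 2), dist z w ≤ |x₁ - x₁'| → dist (H z) (H w) ≤ ρ) :
    Q.IsPerturbationTwo Q' ρ := by
  have hxI : uIcc x₀ x₁ ⊆ Icc (-2 : ℝ) 2 := uIcc_subset_Icc hx₀C hx₁C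
  have hyI : uIcc y₀ y₁ ⊆ Icc (-2 : ℝ) 2 := uIcc_subset_Icc hy₀C hy₁C
  have hsub : uIcc x₀ x₁' ⊆ uIcc x₀ x₁ := uIcc_subset_uIcc left_mem_uIcc hmem
  have hsub' : uIcc x₁' x₁ ⊆ uIcc x₀ x₁ := uIcc_subset_uIcc hmem right_mem_uIcc
  refine ⟨?_, ?_, ?_, ?_, ?_⟩
  · rw [carrier_eq_of_chart hQ hx hy, carrier_eq_of_chart hQ' hx' hy]
    refine image_mono fun z hz => ?_
    rw [Complex.mem_reProdIm] at hz ⊢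
    exact ⟨hsub hz.1, hz.2⟩
  · rw [side_zero_eq_of_chart hQ hy, side_zero_eq_of_chart hQ' hy]
  · rw [side_one_eq_of_chart hQ hx, side_one_eq_of_chart hQ' hx']
    refine image_mono fun z hz => ?_
    rw [Complex.mem_reProdIm] at hz ⊢
    exact ⟨hsub hz.1, hz.2⟩
  · rw [side_three_eq_of_chart hQ hx, side_three_eq_of_chart hQ' hx']
    refine image_mono fun z hz => ?_
    rw [Complex.mem_reProdIm] at hz ⊢
    exact ⟨hsub hz.1, hz.2⟩
  · intro x hxs
    rw [side_two_eq_of_chart hQ' hy] at hxs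
    obtain ⟨z, hz, rfl⟩ := hxs
    rw [Complex.mem_reProdIm, mem_singleton_iff] at hz
    -- the horizontal segment from `x₁' + v i` to `x₁ + v i`, pushed by `H`
    set v := z.im with hv
    have hzeq : z = ((x₁' : ℝ) : ℂ) + ((v : ℝ) : ℂ) * Complex.I :=
      Complex.ext (by rw [(re_im_ofReal_add_ofReal_mul_I _ _).1, hz.1])
        (by rw [(re_im_ofReal_add_ofReal_mul_I _ _).2])
    let γ : Path (H z) (H (((x₁ : ℝ) : ℂ) + ((v : ℝ) : ℂ) * Complex.I)) :=
      { toFun := fun s => H ((((x₁' + (x₁ - x₁') * (s : ℝ) : ℝ) : ℂ)) + ((v : ℝ) : ℂ) * Complex.I)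
        continuous_toFun := by fun_prop
        source' := by simp [hzeq]
        target' := by simp }
    have hpt : ∀ s : I, (((x₁' + (x₁ - x₁') * (s : ℝ) : ℝ) : ℂ) + ((v : ℝ) : ℂ) * Complex.I) ∈
        uIcc x₁' x₁ ×ℂ uIcc y₀ y₁ := fun s => by
      rw [Complex.mem_reProdIm, (re_im_ofReal_add_ofReal_mul_I _ _).1,
        (re_im_ofReal_add_ofReal_mul_I _ _).2]
      exact ⟨affine_mem_uIcc _ _ _, hz.2⟩
    have hrange : range γ ⊆ Q.carrier := by
      rintro _ ⟨s, rfl⟩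
      rw [carrier_eq_of_chart hQ hx hy]
      refine mem_image_of_mem _ ?_
      have := hpt s
      rw [Complex.mem_reProdIm] at this ⊢
      exact ⟨hsub' this.1, this.2⟩
    refine ⟨H (((x₁ : ℝ) : ℂ) + ((v : ℝ) : ℂ) * Complex.I), ?_, γ, hrange, ?_⟩
    · rw [side_two_eq_of_chart hQ hy]
      refine mem_image_of_mem _ ?_
      rw [Complex.mem_reProdIm, (re_im_ofReal_add_ofReal_mul_I _ _).1,
        (re_im_ofReal_add_ofReal_mul_I _ _).2]
      exact ⟨rfl, hz.2⟩
    · refine diam_le_of_forall_dist_le hρ ?_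
      rintro _ ⟨s, rfl⟩ _ ⟨s', rfl⟩
      have h1 := hpt s
      have h2 := hpt s'
      rw [Complex.mem_reProdIm] at h1 h2
      refine hH _ ?_ _ ?_ ?_
      · rw [Complex.mem_reProdIm]; exact ⟨hxI (hsub' h1.1), hyI h1.2⟩
      · rw [Complex.mem_reProdIm]; exact ⟨hxI (hsub' h2.1), hyI h2.2⟩
      · rw [dist_eq_norm]
        refine (norm_ofReal_add_mul_I_sub_le _ _ _ _).trans ?_
        rw [sub_self, abs_zero, add_zero]
        have := abs_sub_le_of_mem_uIcc h1.1 h2.1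
        rw [(re_im_ofReal_add_ofReal_mul_I _ _).1, (re_im_ofReal_add_ofReal_mul_I _ _).1] at this
        rwa [abs_sub_comm x₁ x₁']

/-- **Condition (3) of Lemma 6.1 for a move of side `3`.** Let `Q = H ∘ rectChart x₀ x₁ y₀ y₁` and
`Q' = H ∘ rectChart x₀ x₁ y₀ y₁'` with `y₁' ∈ [[y₀, y₁]]` (so `[Q'] ⊆ [Q]`, `∂₀Q' ⊆ ∂₀Q`,
`∂₁Q' = ∂₁Q`, `∂₂Q' ⊆ ∂₂Q`), all coordinates in `[-2, 2]`, and suppose `H` moves points of `[-2,2]²`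
at distance `≤ |y₁ - y₁'|` to points at distance `≤ ρ`.  Then every point `H(u + y₁' i)` of `∂₃Q'`
is joined to `H(u + y₁ i) ∈ ∂₃Q` by the `H`-image of the vertical segment, a path in `[Q]` of
diameter `≤ ρ`: `Q.IsPerturbationThree Q' ρ`. [cite: SchrammSmirnov2011, Lemma 6.1 (3)] -/
theorem isPerturbationThree_of_chart {y₁' ρ : ℝ} (hQ : ∀ p, Q p = H (rectChart x₀ x₁ y₀ y₁ p))
    (hQ' : ∀ p, Q' p = H (rectChart x₀ x₁ y₀ y₁' p)) (hx : x₀ ≠ x₁) (hy : y₀ ≠ y₁)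
    (hy' : y₀ ≠ y₁') (hmem : y₁' ∈ uIcc y₀ y₁) (hx₀C : x₀ ∈ Icc (-2 : ℝ) 2)
    (hx₁C : x₁ ∈ Icc (-2 : ℝ) 2) (hy₀C : y₀ ∈ Icc (-2 : ℝ) 2) (hy₁C : y₁ ∈ Icc (-2 : ℝ) 2)
    (hρ : 0 ≤ ρ)
    (hH : ∀ z ∈ (Icc (-2 : ℝ) 2 ×ℂ Icc (-2 : ℝ) 2), ∀ w ∈ (Icc (-2 : ℝ) 2 ×ℂ Icc (-2 : ℝ) 2), dist z w ≤ |y₁ - y₁'| → dist (H z) (H w) ≤ ρ) :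
    Q.IsPerturbationThree Q' ρ := by
  have hxI : uIcc x₀ x₁ ⊆ Icc (-2 : ℝ) 2 := uIcc_subset_Icc hx₀C hx₁C
  have hyI : uIcc y₀ y₁ ⊆ Icc (-2 : ℝ) 2 := uIcc_subset_Icc hy₀C hy₁C
  have hsub : uIcc y₀ y₁' ⊆ uIcc y₀ y₁ := uIcc_subset_uIcc left_mem_uIcc hmem
  have hsub' : uIcc y₁' y₁ ⊆ uIcc y₀ y₁ := uIcc_subset_uIcc hmem right_mem_uIcc
  refine ⟨?_, ?_, ?_, ?_, ?_⟩
  · rw [carrier_eq_of_chart hQ hx hy, carrier_eq_of_chart hQ' hx hy']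
    refine image_mono fun z hz => ?_
    rw [Complex.mem_reProdIm] at hz ⊢
    exact ⟨hz.1, hsub hz.2⟩
  · rw [side_zero_eq_of_chart hQ hy, side_zero_eq_of_chart hQ' hy']
    refine image_mono fun z hz => ?_
    rw [Complex.mem_reProdIm] at hz ⊢
    exact ⟨hz.1, hsub hz.2⟩
  · rw [side_one_eq_of_chart hQ hx, side_one_eq_of_chart hQ' hx]
  · rw [side_two_eq_of_chart hQ hy, side_two_eq_of_chart hQ' hy']
    refine image_mono fun z hz => ?_
    rw [Complex.mem_reProdIm] at hz ⊢
    exact ⟨hz.1, hsub hz.2⟩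
  · intro x hxs
    rw [side_three_eq_of_chart hQ' hx] at hxs
    obtain ⟨z, hz, rfl⟩ := hxs
    rw [Complex.mem_reProdIm, mem_singleton_iff] at hz
    set u := z.re with hu
    have hzeq : z = ((u : ℝ) : ℂ) + ((y₁' : ℝ) : ℂ) * Complex.I :=
      Complex.ext (by rw [(re_im_ofReal_add_ofReal_mul_I _ _).1])
        (by rw [(re_im_ofReal_add_ofReal_mul_I _ _).2, hz.2])
    let γ : Path (H z) (H (((u : ℝ) : ℂ) + ((y₁ : ℝ) : ℂ) * Complex.I)) :=
      { toFun := fun s => H (((u : ℝ) : ℂ) + (((y₁' + (y₁ - y₁') * (s : ℝ) : ℝ) : ℂ)) * Complex.I)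
        continuous_toFun := by fun_prop
        source' := by simp [hzeq]
        target' := by simp }
    have hpt : ∀ s : I, (((u : ℝ) : ℂ) + (((y₁' + (y₁ - y₁') * (s : ℝ) : ℝ) : ℂ)) * Complex.I) ∈
        uIcc x₀ x₁ ×ℂ uIcc y₁' y₁ := fun s => by
      rw [Complex.mem_reProdIm, (re_im_ofReal_add_ofReal_mul_I _ _).1,
        (re_im_ofReal_add_ofReal_mul_I _ _).2]
      exact ⟨hz.1, affine_mem_uIcc _ _ _⟩
    have hrange : range γ ⊆ Q.carrier := by
      rintro _ ⟨s, rfl⟩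
      rw [carrier_eq_of_chart hQ hx hy]
      refine mem_image_of_mem _ ?_
      have := hpt s
      rw [Complex.mem_reProdIm] at this ⊢
      exact ⟨this.1, hsub' this.2⟩
    refine ⟨H (((u : ℝ) : ℂ) + ((y₁ : ℝ) : ℂ) * Complex.I), ?_, γ, hrange, ?_⟩
    · rw [side_three_eq_of_chart hQ hx]
      refine mem_image_of_mem _ ?_
      rw [Complex.mem_reProdIm, (re_im_ofReal_add_ofReal_mul_I _ _).1,
        (re_im_ofReal_add_ofReal_mul_I _ _).2]
      exact ⟨hz.1, rfl⟩
    · refine diam_le_of_forall_dist_le hρ ?_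
      rintro _ ⟨s, rfl⟩ _ ⟨s', rfl⟩
      have h1 := hpt s
      have h2 := hpt s'
      rw [Complex.mem_reProdIm] at h1 h2
      refine hH _ ?_ _ ?_ ?_
      · rw [Complex.mem_reProdIm]; exact ⟨hxI h1.1, hyI (hsub' h1.2)⟩
      · rw [Complex.mem_reProdIm]; exact ⟨hxI h2.1, hyI (hsub' h2.2)⟩
      · rw [dist_eq_norm]
        refine (norm_ofReal_add_mul_I_sub_le _ _ _ _).trans ?_
        rw [sub_self, abs_zero, zero_add]
        have := abs_sub_le_of_mem_uIcc h1.2 h2.2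
        rw [(re_im_ofReal_add_ofReal_mul_I _ _).2, (re_im_ofReal_add_ofReal_mul_I _ _).2] at this
        rwa [abs_sub_comm y₁ y₁']

/-! ### A uniform lower bound for the size parameter of the larger quads -/

/-- **`d₀(Q) ≥ m(H) > 0` for all chart quads whose sides `0`, `2` lie over `{x ≤ -1/2}` and
`{x ≥ 1/2}`** (in either order), coordinates in `[-2, 2]`: every path from `∂₀Q` to `∂₂Q` has
diameter at least the distance of its endpoints, which lie in the disjoint compact sets
`H([-2,-1/2] × [-2,2])`, `H([1/2,2] × [-2,2])`. [cite: SchrammSmirnov2011, Lemma 6.1 (the parameter d)] -/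
theorem exists_pos_le_sideDist_zero_of_chart (H : ℂ ≃ₜ ℂ) :
    ∃ m : ℝ, 0 < m ∧ ∀ {D : Set ℂ} (Q : Quad D) (x₀ x₁ y₀ y₁ : ℝ),
      (∀ p, Q p = H (rectChart x₀ x₁ y₀ y₁ p)) → y₀ ≠ y₁ →
      y₀ ∈ Icc (-2 : ℝ) 2 → y₁ ∈ Icc (-2 : ℝ) 2 →
      (x₀ ∈ Icc (-2 : ℝ) (-1/2) ∧ x₁ ∈ Icc (1/2 : ℝ) 2 ∨
        x₁ ∈ Icc (-2 : ℝ) (-1/2) ∧ x₀ ∈ Icc (1/2 : ℝ) 2) → m ≤ Q.sideDist 0 := by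
  set L := H '' (Icc (-2 : ℝ) (-1/2) ×ℂ Icc (-2 : ℝ) 2) with hL
  set R := H '' (Icc (1/2 : ℝ) 2 ×ℂ Icc (-2 : ℝ) 2) with hR
  have hLc : IsCompact L := (isCompact_Icc.reProdIm isCompact_Icc).image H.continuous
  have hRc : IsCompact R := (isCompact_Icc.reProdIm isCompact_Icc).image H.continuous
  have hdisj : Disjoint L R := by
    rw [Set.disjoint_iff]
    rintro _ ⟨⟨z, hz, rfl⟩, ⟨w, hw, hzw⟩⟩
    have : w = z := H.injective hzw
    subst this
    rw [Complex.mem_reProdIm, mem_Icc] at hz hw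
    linarith [hz.1.2, hw.1.1]
  obtain ⟨m, hm, hdisj'⟩ := hdisj.exists_cthickenings hLc hRc.isClosed
  have hdist : ∀ x ∈ L, ∀ y ∈ R, m ≤ dist x y := fun x hx y hy => by
    by_contra hlt
    push Not at hlt
    exact Set.disjoint_left.1 hdisj'
      (mem_cthickening_of_dist_le y x m L hx (by rw [dist_comm]; exact hlt.le))
      (self_subset_cthickening _ hy)
  refine ⟨m, hm, fun Q x₀ x₁ y₀ y₁ hQ hy hy₀ hy₁ hx => ?_⟩
  refine le_sideDist fun x hxs y hys γ _ => le_trans ?_ (dist_le_diam_range_path γ)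
  rw [side_zero_eq_of_chart hQ hy] at hxs
  rw [show (0 : Fin 4) + 2 = 2 from rfl, side_two_eq_of_chart hQ hy] at hys
  obtain ⟨z, hz, rfl⟩ := hxs
  obtain ⟨w, hw, rfl⟩ := hys
  rw [Complex.mem_reProdIm, mem_singleton_iff] at hz hw
  have hyI : uIcc y₀ y₁ ⊆ Icc (-2 : ℝ) 2 := uIcc_subset_Icc hy₀ hy₁
  rcases hx with ⟨h₀, h₁⟩ | ⟨h₁, h₀⟩
  · refine hdist _ (mem_image_of_mem _ ?_) _ (mem_image_of_mem _ ?_)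
    · rw [Complex.mem_reProdIm, hz.1]; exact ⟨h₀, hyI hz.2⟩
    · rw [Complex.mem_reProdIm, hw.1]; exact ⟨h₁, hyI hw.2⟩
  · rw [dist_comm]
    refine hdist _ (mem_image_of_mem _ ?_) _ (mem_image_of_mem _ ?_)
    · rw [Complex.mem_reProdIm, hw.1]; exact ⟨h₁, hyI hw.2⟩
    · rw [Complex.mem_reProdIm, hz.1]; exact ⟨h₀, hyI hz.2⟩

/-- **`d(Q) ≥ d₀(Q) ≥ m(H) > 0`** for the same chart quads (`exists_pos_le_sideDist_zero_of_chart`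
and `d₀ ≤ d = max{d₀, d₁}`). [cite: SchrammSmirnov2011, Lemma 6.1 (the parameter d)] -/
theorem exists_pos_le_sizeParam_of_chart (H : ℂ ≃ₜ ℂ) :
    ∃ m : ℝ, 0 < m ∧ ∀ {D : Set ℂ} (Q : Quad D) (x₀ x₁ y₀ y₁ : ℝ),
      (∀ p, Q p = H (rectChart x₀ x₁ y₀ y₁ p)) → y₀ ≠ y₁ →
      y₀ ∈ Icc (-2 : ℝ) 2 → y₁ ∈ Icc (-2 : ℝ) 2 →
      (x₀ ∈ Icc (-2 : ℝ) (-1/2) ∧ x₁ ∈ Icc (1/2 : ℝ) 2 ∨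
        x₁ ∈ Icc (-2 : ℝ) (-1/2) ∧ x₀ ∈ Icc (1/2 : ℝ) 2) → m ≤ Q.sizeParam := by
  obtain ⟨m, hm, h⟩ := exists_pos_le_sideDist_zero_of_chart H
  exact ⟨m, hm, fun Q x₀ x₁ y₀ y₁ hQ hy hy₀ hy₁ hx =>
    (h Q x₀ x₁ y₀ y₁ hQ hy hy₀ hy₁ hx).trans Q.sideDist_zero_le_sizeParam⟩

end Moves

end Quad

/-! ### The crossing events of the discrete configuration and the Schramm–Smirnov laws -/

variable {D : Set ℂ}

/-- **Push-forward identity.** For `D` open and `δ > 0`,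
`P_{1/2}({Q crossed inside the open edges of δℤ²} Δ {Q' crossed …}) = μ_{δ/√2}(⊞_Q Δ ⊞_{Q'})`,
where `μ_η = squareCrossingLaw D η = z2QuadLaw D (η√2)` is the push-forward of `P_{1/2}` by the
(measurable, `measurable_z2QuadConfig`) encoding `ω ↦ ω_δ`, and `Q ∈ ω_δ ↔ Q` has a crossing inside
the open edges (`mem_z2QuadConfig_iff_exists_isCrossing`). [cite: SchrammSmirnov2011, §1.3] -/
theorem measureReal_symmDiff_setOf_exists_isCrossing (hD : IsOpen D) {δ : ℝ} (hδ : 0 < δ)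
    (Q Q' : Quad D) :
    (bondPercolation (zdGraph 2) half).real
        (symmDiff {ω | ∃ K, Q.IsCrossing K ∧ K ⊆ openEdgeUnion δ ω}
          {ω | ∃ K, Q'.IsCrossing K ∧ K ⊆ openEdgeUnion δ ω}) =
      (squareCrossingLaw D (δ / Real.sqrt 2) : Measure (QuadConfig D)).real
        (symmDiff (QuadConfig.crossedEvent Q) (QuadConfig.crossedEvent Q')) := by
  have h2 : (0 : ℝ) < Real.sqrt 2 := Real.sqrt_pos.mpr (by norm_num)
  rw [squareCrossingLaw_eq_z2QuadLaw, div_mul_cancel₀ _ h2.ne', toMeasure_z2QuadLaw,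
    measureReal_def, measureReal_def,
    Measure.map_apply (measurable_z2QuadConfig hD hδ)
      ((QuadConfig.measurableSet_crossedEvent Q).symmDiff (QuadConfig.measurableSet_crossedEvent Q'))]
  congr 2
  ext ω
  simp only [mem_preimage, Set.mem_symmDiff, mem_setOf_eq, QuadConfig.crossedEvent,
    mem_z2QuadConfig_iff_exists_isCrossing hδ]

/-- **Chain estimate**: for five events, `μ(S₀ ∖ S₄)` is at most the sum of the measures of the
four consecutive symmetric differences (`S₀ ∖ S₄ ⊆ ⋃ᵢ Sᵢ Δ Sᵢ₊₁`). [folklore] -/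
theorem measureReal_diff_le_chain {α : Type*} {_ : MeasurableSpace α} (μ : Measure α)
    [IsFiniteMeasure μ] (S₀ S₁ S₂ S₃ S₄ : Set α) :
    μ.real (S₀ \ S₄) ≤ μ.real (symmDiff S₀ S₁) + μ.real (symmDiff S₁ S₂) +
      μ.real (symmDiff S₂ S₃) + μ.real (symmDiff S₃ S₄) := by
  have hsub : S₀ \ S₄ ⊆
      ((symmDiff S₀ S₁ ∪ symmDiff S₁ S₂) ∪ symmDiff S₂ S₃) ∪ symmDiff S₃ S₄ := by
    rintro ω ⟨h₀, h₄⟩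
    simp only [mem_union, Set.mem_symmDiff]
    by_cases g₁ : ω ∈ S₁ <;> by_cases g₂ : ω ∈ S₂ <;> by_cases g₃ : ω ∈ S₃ <;> tauto
  calc μ.real (S₀ \ S₄)
      ≤ μ.real (((symmDiff S₀ S₁ ∪ symmDiff S₁ S₂) ∪ symmDiff S₂ S₃) ∪ symmDiff S₃ S₄) :=
        measureReal_mono hsub
    _ ≤ μ.real ((symmDiff S₀ S₁ ∪ symmDiff S₁ S₂) ∪ symmDiff S₂ S₃) + μ.real (symmDiff S₃ S₄) :=
        measureReal_union_le _ _
    _ ≤ μ.real (symmDiff S₀ S₁ ∪ symmDiff S₁ S₂) + μ.real (symmDiff S₂ S₃) +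
          μ.real (symmDiff S₃ S₄) := by
        gcongr; exact measureReal_union_le _ _
    _ ≤ μ.real (symmDiff S₀ S₁) + μ.real (symmDiff S₁ S₂) + μ.real (symmDiff S₂ S₃) +
          μ.real (symmDiff S₃ S₄) := by
        gcongr; exact measureReal_union_le _ _

/-! ### (5.1) from the scale-free bound -/

namespace Quad

/-- **One step of the chain (uniform form).**  If the crossing events of a `ρ`-perturbation of
type (2) or (3) of ANY quad `Q` with `d₀(Q) ≥ m` differ by at most `ε'` in `μ_η`-measure for all
`0 < η < ρ`, and the larger quad `P` of a comparison is a chart quad with sides `0`, `2` over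
`{x ≤ -1/2}`, `{x ≥ 1/2}` (so `d₀(P) ≥ m`, `exists_pos_le_sideDist_zero_of_chart`), then for every
mesh `0 < δ < ρ` the crossing events of `P` and `P'` inside the open edges of `δℤ²` differ on an
event of `P_{1/2}`-probability `≤ ε'`. [cite: SchrammSmirnov2011, Lemma 5.1 (proof, §5 p. 21)] -/
theorem measureReal_symmDiff_le_of_step {ε' ρ m : ℝ} {H : ℂ ≃ₜ ℂ}
    (hmd : ∀ {D : Set ℂ} (Q : Quad D) (x₀ x₁ y₀ y₁ : ℝ),
      (∀ p, Q p = H (rectChart x₀ x₁ y₀ y₁ p)) → y₀ ≠ y₁ →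
      y₀ ∈ Icc (-2 : ℝ) 2 → y₁ ∈ Icc (-2 : ℝ) 2 →
      (x₀ ∈ Icc (-2 : ℝ) (-1/2) ∧ x₁ ∈ Icc (1/2 : ℝ) 2 ∨
        x₁ ∈ Icc (-2 : ℝ) (-1/2) ∧ x₀ ∈ Icc (1/2 : ℝ) 2) → m ≤ Q.sideDist 0)
    (hUρ : ∀ (D : Set ℂ) (Q Q' : Quad D), m ≤ Q.sideDist 0 →
      (Q.IsPerturbationTwo Q' ρ ∨ Q.IsPerturbationThree Q' ρ) → ∀ η : ℝ, 0 < η → η < ρ →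
        (squareCrossingLaw D η : Measure (QuadConfig D)).real
            (symmDiff (QuadConfig.crossedEvent Q) (QuadConfig.crossedEvent Q')) ≤ ε')
    (hD : IsOpen D) {δ : ℝ} (hδ : 0 < δ) (hδρ : δ < ρ)
    {P P' : Quad D} {u₀ u₁ v₀ v₁ : ℝ} (hP : ∀ p, P p = H (rectChart u₀ u₁ v₀ v₁ p))
    (hv : v₀ ≠ v₁) (hv₀ : v₀ ∈ Icc (-2 : ℝ) 2) (hv₁ : v₁ ∈ Icc (-2 : ℝ) 2)
    (hu : u₀ ∈ Icc (-2 : ℝ) (-1/2) ∧ u₁ ∈ Icc (1/2 : ℝ) 2 ∨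
      u₁ ∈ Icc (-2 : ℝ) (-1/2) ∧ u₀ ∈ Icc (1/2 : ℝ) 2)
    (hcond : P.IsPerturbationTwo P' ρ ∨ P.IsPerturbationThree P' ρ) :
    (bondPercolation (zdGraph 2) half).real
        (symmDiff {ω | ∃ K, P.IsCrossing K ∧ K ⊆ openEdgeUnion δ ω}
          {ω | ∃ K, P'.IsCrossing K ∧ K ⊆ openEdgeUnion δ ω}) ≤ ε' := by
  have hmP : m ≤ P.sideDist 0 := hmd P u₀ u₁ v₀ v₁ hP hv hv₀ hv₁ hu
  have h2 : (1 : ℝ) < Real.sqrt 2 := Real.one_lt_sqrt_two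
  have hη : 0 < δ / Real.sqrt 2 := div_pos hδ (by linarith)
  have hηρ : δ / Real.sqrt 2 < ρ := (div_lt_self hδ h2).trans hδρ
  rw [measureReal_symmDiff_setOf_exists_isCrossing hD hδ]
  exact hUρ D P P' hmP hcond (δ / Real.sqrt 2) hη hηρ

/-- **One step of the chain.**  Under the scale-free bound for conditions (2), (3): if the larger
quad `P` of a comparison is a chart quad with sides `0`, `2` over `{x ≤ -1/2}`, `{x ≥ 1/2}` (so
`d(P) ≥ m`, `exists_pos_le_sizeParam_of_chart`), `ρ ≤ min(x₀ m/2, c m)` where `F < ε'` on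
`(0, x₀)`, and `P'` is a `ρ`-perturbation of `P` of type (2) or (3), then for every mesh
`0 < δ < ρ` the crossing events of `P` and `P'` inside the open edges of `δℤ²` differ on an event
of probability `< ε'`. [cite: SchrammSmirnov2011, Lemma 5.1 (proof, §5 p. 21)] -/
theorem measureReal_symmDiff_lt_of_step {c : ℝ} (hc : 0 < c) {F : ℝ → ℝ}
    (hb : ∀ (D : Set ℂ) (Q Q' : Quad D) (ρ : ℝ), 0 < ρ → ρ ≤ c * Q.sizeParam →
      (Q.IsPerturbationTwo Q' ρ ∨ Q.IsPerturbationThree Q' ρ) → ∀ η : ℝ, 0 < η → η < ρ →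
        (squareCrossingLaw D η : Measure (QuadConfig D)).real
            (symmDiff (QuadConfig.crossedEvent Q) (QuadConfig.crossedEvent Q')) ≤
          F (ρ / Q.sizeParam))
    {ε' x₀ : ℝ} (hFx : ∀ x : ℝ, 0 < x → x < x₀ → F x < ε')
    {H : ℂ ≃ₜ ℂ} {m : ℝ} (hm : 0 < m)
    (hmd : ∀ {D : Set ℂ} (Q : Quad D) (x₀ x₁ y₀ y₁ : ℝ),
      (∀ p, Q p = H (rectChart x₀ x₁ y₀ y₁ p)) → y₀ ≠ y₁ →
      y₀ ∈ Icc (-2 : ℝ) 2 → y₁ ∈ Icc (-2 : ℝ) 2 →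
      (x₀ ∈ Icc (-2 : ℝ) (-1/2) ∧ x₁ ∈ Icc (1/2 : ℝ) 2 ∨
        x₁ ∈ Icc (-2 : ℝ) (-1/2) ∧ x₀ ∈ Icc (1/2 : ℝ) 2) → m ≤ Q.sizeParam)
    {ρ : ℝ} (hρ : 0 < ρ) (hρx : ρ ≤ x₀ * m / 2) (hρc : ρ ≤ c * m)
    (hD : IsOpen D) {δ : ℝ} (hδ : 0 < δ) (hδρ : δ < ρ)
    {P P' : Quad D} {u₀ u₁ v₀ v₁ : ℝ} (hP : ∀ p, P p = H (rectChart u₀ u₁ v₀ v₁ p))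
    (hv : v₀ ≠ v₁) (hv₀ : v₀ ∈ Icc (-2 : ℝ) 2) (hv₁ : v₁ ∈ Icc (-2 : ℝ) 2)
    (hu : u₀ ∈ Icc (-2 : ℝ) (-1/2) ∧ u₁ ∈ Icc (1/2 : ℝ) 2 ∨
      u₁ ∈ Icc (-2 : ℝ) (-1/2) ∧ u₀ ∈ Icc (1/2 : ℝ) 2)
    (hcond : P.IsPerturbationTwo P' ρ ∨ P.IsPerturbationThree P' ρ) :
    (bondPercolation (zdGraph 2) half).real
        (symmDiff {ω | ∃ K, P.IsCrossing K ∧ K ⊆ openEdgeUnion δ ω}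
          {ω | ∃ K, P'.IsCrossing K ∧ K ⊆ openEdgeUnion δ ω}) < ε' := by
  have hmP : m ≤ P.sizeParam := hmd P u₀ u₁ v₀ v₁ hP hv hv₀ hv₁ hu
  have hdP : 0 < P.sizeParam := hm.trans_le hmP
  have hρP : ρ ≤ c * P.sizeParam := hρc.trans (mul_le_mul_of_nonneg_left hmP hc.le)
  have h2 : (1 : ℝ) < Real.sqrt 2 := Real.one_lt_sqrt_two
  have hη : 0 < δ / Real.sqrt 2 := div_pos hδ (by linarith)
  have hηρ : δ / Real.sqrt 2 < ρ := (div_lt_self hδ h2).trans hδρ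
  rw [measureReal_symmDiff_setOf_exists_isCrossing hD hδ]
  refine (hb D P P' ρ hρ hρP hcond (δ / Real.sqrt 2) hη hηρ).trans_lt (hFx _ (div_pos hρ hdP) ?_)
  have hx₀ : 0 < x₀ := by
    have : 0 < x₀ * m / 2 := hρ.trans_le hρx
    nlinarith
  calc ρ / P.sizeParam ≤ ρ / m := div_le_div_of_nonneg_left hρ.le hm hmP
    _ ≤ (x₀ * m / 2) / m := div_le_div_of_nonneg_right hρx hm.le
    _ = x₀ / 2 := by field_simp
    _ < x₀ := by linarith

/-- **Schramm–Smirnov's (5.1) for critical bond percolation on `δℤ²`, from UNIFORM continuity of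
the crossing events under conditions (2), (3) of Lemma 6.1** — the weakest input the printed
argument uses.  Hypothesis `hU`: for every scale `m > 0` and `ε > 0` there is `ρ₀ > 0` such that
for all `0 < ρ ≤ ρ₀`, all `D`, all quads `Q` of `D` with `d₀(Q) ≥ m` and all `ρ`-perturbations
`Q'` of `Q` of type (2) or (3), `μ_η(⊞_Q Δ ⊞_{Q'}) ≤ ε` for all `0 < η < ρ` (implied by the
scale-free bound of `SchrammSmirnov2011_lemma_6_1_of_bound`, `uniform_of_bound`; by any bound
antitone in the size parameter; and by per-case power laws in `ρ/d₀(Q)` such as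
`QuadCrossingContinuityCaseTwoSmall`).  Conclusion, for `D` open, `Q₀ ∈ 𝒬_D` and `ε > 0`: there
are quads `Q' < Q₀ < Q''` of `D` (the perturbations `Q^{q_{∓s}}` of `Quad.exists_perturbations`)
and `δ₀ > 0` such that for every mesh `0 < δ < δ₀`,
`P_{1/2}[Q' has a crossing inside the open edges of δℤ² and Q'' has none] ≤ ε`.  Proof: the chain
`Q' = [-a,a]×[-b,b] → [-a,a]×[-B,b] → [-a,a]×[-B,B] → [-A,a]×[-B,B] → [-A,A]×[-B,B] = Q''`
(`a = 1-s`, `A = 1/(1-s)`, `b = 1+s`, `B = 1/(1+s)`, in the straightening chart `H`) of four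
one-coordinate moves, each an instance of condition (3) or (2) for the pair or the reversed pair;
`d₀ ≥ m(H)` for the four larger quads (`exists_pos_le_sideDist_zero_of_chart`), so `ρ := ρ₀(m, ε/4)`
is fixed BEFORE `s`, which is then taken small enough (uniform continuity of `H` on `[-2,2]²`) to
make the moves `ρ`-short; the four bounds add up (`measureReal_diff_le_chain`,
`measureReal_symmDiff_setOf_exists_isCrossing`).
[cite: SchrammSmirnov2011, Lemma 5.1 (proof, §5 p. 21, eq. (5.1)); Lemma 6.1] -/
theorem continuity_of_uniform
    (hU : ∀ m : ℝ, 0 < m → ∀ ε : ℝ, 0 < ε → ∃ ρ₀ : ℝ, 0 < ρ₀ ∧ ∀ ρ : ℝ, 0 < ρ → ρ ≤ ρ₀ →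
      ∀ (D : Set ℂ) (Q Q' : Quad D), m ≤ Q.sideDist 0 →
        (Q.IsPerturbationTwo Q' ρ ∨ Q.IsPerturbationThree Q' ρ) → ∀ η : ℝ, 0 < η → η < ρ →
          (squareCrossingLaw D η : Measure (QuadConfig D)).real
              (symmDiff (QuadConfig.crossedEvent Q) (QuadConfig.crossedEvent Q')) ≤ ε)
    (hD : IsOpen D) (Q₀ : Quad D) (ε : ℝ≥0∞) (hε : 0 < ε) :
    ∃ Q' Q'' : Quad D, StrictlyDominated Q' Q₀ ∧ StrictlyDominated Q₀ Q'' ∧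
      ∃ δ₀ : ℝ, 0 < δ₀ ∧ ∀ δ : ℝ, 0 < δ → δ < δ₀ →
        bondPercolation (zdGraph 2) half
          {ω | (∃ K, Q'.IsCrossing K ∧ K ⊆ openEdgeUnion δ ω) ∧
            ¬ ∃ K, Q''.IsCrossing K ∧ K ⊆ openEdgeUnion δ ω} ≤ ε := by
  -- a real `ε' > 0` with `4 ε' ≤ ε`
  obtain ⟨ε', hε', hε'ε⟩ : ∃ ε' : ℝ, 0 < ε' ∧ ENNReal.ofReal (4 * ε') ≤ ε := by
    rcases eq_or_ne ε ⊤ with h | h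
    · exact ⟨1, one_pos, h ▸ le_top⟩
    · refine ⟨ε.toReal / 4, div_pos (ENNReal.toReal_pos hε.ne' h) (by norm_num), ?_⟩
      rw [mul_div_cancel₀ _ (by norm_num : (4 : ℝ) ≠ 0), ENNReal.ofReal_toReal h]
  -- the perturbations and the straightening chart `H`
  obtain ⟨H, -, t₀, ht₀, ht₀', hpert⟩ := exists_perturbations hD Q₀
  -- the uniform lower bound `m` for `d₀` of the larger quads
  obtain ⟨m, hm, hmd⟩ := exists_pos_le_sideDist_zero_of_chart H
  -- the perturbation size `ρ`
  obtain ⟨ρ, hρ, hUρ⟩ := hU m hm ε' hε'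
  replace hUρ := hUρ ρ hρ le_rfl
  -- uniform continuity of `H` on `[-2, 2]²`: moves of size `≤ θ` are `ρ`-short
  obtain ⟨θ, hθ, hHθ⟩ : ∃ θ : ℝ, 0 < θ ∧ ∀ r : ℝ, r ≤ θ →
      ∀ z ∈ (Icc (-2 : ℝ) 2 ×ℂ Icc (-2 : ℝ) 2), ∀ w ∈ (Icc (-2 : ℝ) 2 ×ℂ Icc (-2 : ℝ) 2), dist z w ≤ r → dist (H z) (H w) ≤ ρ := by
    have hCc : IsCompact (Icc (-2 : ℝ) 2 ×ℂ Icc (-2 : ℝ) 2) := isCompact_Icc.reProdIm isCompact_Icc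
    obtain ⟨θ, hθ, hHθ⟩ := Metric.uniformContinuousOn_iff.1
      (hCc.uniformContinuousOn_of_continuous H.continuous.continuousOn) ρ hρ
    exact ⟨θ / 2, by linarith, fun r hr z hz w hw hzw => (hHθ z hz w hw (by linarith)).le⟩
  -- the parameter `t` and the perturbations `Q' = Qm`, `Q'' = Qp`
  obtain ⟨t, ht, htt₀, htθ, ht2⟩ : ∃ t : ℝ, 0 < t ∧ t ≤ t₀ ∧ 4 * t ≤ θ ∧ t ≤ 1 / 2 :=
    ⟨min t₀ (θ / 4), lt_min ht₀ (by linarith), min_le_left _ _,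
      by linarith [min_le_right t₀ (θ / 4)], (min_le_left _ _).trans ht₀'⟩
  obtain ⟨Qm, Qp, hQm, hQp, hlt₁, hlt₂⟩ := hpert t ht htt₀
  -- the coordinates `a = 1 - t`, `A = 1/a`, `b = 1 + t`, `B = 1/b` and their bounds
  obtain ⟨a, ha_def⟩ : ∃ a : ℝ, a = 1 - t := ⟨_, rfl⟩
  obtain ⟨b, hb_def⟩ : ∃ b : ℝ, b = 1 + t := ⟨_, rfl⟩
  have hapos : 0 < a := by rw [ha_def]; linarith
  have hbpos : 0 < b := by rw [hb_def]; linarith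
  obtain ⟨A, hA_def⟩ : ∃ A : ℝ, A = a⁻¹ := ⟨_, rfl⟩
  obtain ⟨B, hB_def⟩ : ∃ B : ℝ, B = b⁻¹ := ⟨_, rfl⟩
  have ha : 1 / 2 ≤ a := by rw [ha_def]; linarith
  have ha1 : a < 1 := by rw [ha_def]; linarith
  have hb1 : 1 < b := by rw [hb_def]; linarith
  have hb2 : b ≤ 3 / 2 := by rw [hb_def]; linarith
  have hA1 : 1 < A := by rw [hA_def, inv_eq_one_div, lt_div_iff₀ hapos]; linarith
  have hA2 : A ≤ 2 := by rw [hA_def, inv_eq_one_div, div_le_iff₀ hapos]; linarith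
  have hB1 : B < 1 := by rw [hB_def, inv_eq_one_div, div_lt_iff₀ hbpos]; linarith
  have hB2 : 1 / 2 ≤ B := by rw [hB_def, inv_eq_one_div, le_div_iff₀ hbpos]; linarith
  have hAa : |(-A) - (-a)| ≤ θ := by
    have h1 : A ≤ a + 4 * t := by
      rw [hA_def, inv_eq_one_div, div_le_iff₀ hapos, ha_def]
      nlinarith [mul_nonneg ht.le (by linarith : (0 : ℝ) ≤ 2 - 3 * t)]
    rw [show (-A) - (-a) = -(A - a) by ring, abs_neg, abs_of_nonneg (by linarith)]
    linarith
  have hAa' : |A - a| ≤ θ := by rwa [show (-A) - (-a) = -(A - a) by ring, abs_neg] at hAa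
  have hbB : |b - B| ≤ θ := by
    have h1 : b - 4 * t ≤ B := by
      rw [hB_def, inv_eq_one_div, le_div_iff₀ hbpos, hb_def]
      nlinarith [mul_nonneg ht.le (by linarith : (0 : ℝ) ≤ 3 * t + 2)]
    rw [abs_of_nonneg (by linarith)]
    linarith
  have hbB' : |(-b) - (-B)| ≤ θ := by rwa [show (-b) - (-B) = -(b - B) by ring, abs_neg]
  -- interval memberships (all coordinates lie in `[-2, 2]`)
  have haC : a ∈ Icc (-2 : ℝ) 2 := ⟨by linarith, by linarith⟩
  have hnaC : -a ∈ Icc (-2 : ℝ) 2 := ⟨by linarith, by linarith⟩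
  have hAC : A ∈ Icc (-2 : ℝ) 2 := ⟨by linarith, by linarith⟩
  have hnAC : -A ∈ Icc (-2 : ℝ) 2 := ⟨by linarith, by linarith⟩
  have hbC : b ∈ Icc (-2 : ℝ) 2 := ⟨by linarith, by linarith⟩
  have hnbC : -b ∈ Icc (-2 : ℝ) 2 := ⟨by linarith, by linarith⟩
  have hBC : B ∈ Icc (-2 : ℝ) 2 := ⟨by linarith, by linarith⟩
  have hnBC : -B ∈ Icc (-2 : ℝ) 2 := ⟨by linarith, by linarith⟩
  have haR : a ∈ Icc (1 / 2 : ℝ) 2 := ⟨ha, by linarith⟩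
  have hnaL : -a ∈ Icc (-2 : ℝ) (-1 / 2) := ⟨by linarith, by linarith⟩
  have hAR : A ∈ Icc (1 / 2 : ℝ) 2 := ⟨by linarith, hA2⟩
  have hnAL : -A ∈ Icc (-2 : ℝ) (-1 / 2) := ⟨by linarith, by linarith⟩
  have hane : (-a : ℝ) ≠ a := by linarith
  have hana : (a : ℝ) ≠ -a := by linarith
  have hAne : (-A : ℝ) ≠ A := by linarith
  have hbne : (-b : ℝ) ≠ b := by linarith
  have hbnb : (b : ℝ) ≠ -b := by linarith
  have hBne : (-B : ℝ) ≠ B := by linarith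
  have hBnB : (B : ℝ) ≠ -B := by linarith
  have hnAa : (-A : ℝ) ≠ a := by linarith
  have hanA : (a : ℝ) ≠ -A := by linarith
  have hnBb : (-B : ℝ) ≠ b := by linarith
  have hbnB : (b : ℝ) ≠ -B := by linarith
  have hmB_b : -B ∈ uIcc (-b) b := by
    rw [uIcc_of_le (by linarith)]; exact ⟨by linarith, by linarith⟩
  have hmB_b' : -B ∈ uIcc b (-b) := by rw [uIcc_comm]; exact hmB_b
  have hB_Bb : B ∈ uIcc (-B) b := by
    rw [uIcc_of_le (by linarith)]; exact ⟨by linarith, by linarith⟩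
  have hma_A : -a ∈ uIcc (-A) A := by
    rw [uIcc_of_le (by linarith)]; exact ⟨by linarith, by linarith⟩
  have ha_A : a ∈ uIcc (-A) A := by
    rw [uIcc_of_le (by linarith)]; exact ⟨by linarith, by linarith⟩
  have hma_aA : -a ∈ uIcc a (-A) := by
    rw [uIcc_of_ge (by linarith)]; exact ⟨by linarith, by linarith⟩
  -- chart presentations of `Q' = Qm` and `Q'' = Qp`
  have hQm' : ∀ p, Qm p = H (rectChart (-a) a (-b) b p) := fun p => by
    rw [hQm p]; congr 1; simp only [rectChart, ha_def, hb_def]; push_cast; ring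
  have hQp' : ∀ p, Qp p = H (rectChart (-A) A (-B) B p) := fun p => by
    rw [hQp p]; congr 1; simp only [rectChart, hA_def, hB_def, ha_def, hb_def]; push_cast; ring
  -- the intermediate quads and the reversed presentations
  obtain ⟨Qmr, hQmr⟩ := exists_quad_of_chart_sub hQm' hane hbne right_mem_uIcc left_mem_uIcc
    right_mem_uIcc left_mem_uIcc hana hbnb
  obtain ⟨C₁, hC₁⟩ := exists_quad_of_chart_sub hQm' hane hbne left_mem_uIcc right_mem_uIcc
    hmB_b right_mem_uIcc hane hnBb
  obtain ⟨C₁r, hC₁r⟩ := exists_quad_of_chart_sub hQm' hane hbne right_mem_uIcc left_mem_uIcc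
    right_mem_uIcc hmB_b hana hbnB
  obtain ⟨C₂, hC₂⟩ := exists_quad_of_chart_sub hQp' hAne hBne hma_A ha_A left_mem_uIcc
    right_mem_uIcc hane hBne
  obtain ⟨C₂r, hC₂r⟩ := exists_quad_of_chart_sub hQp' hAne hBne ha_A hma_A right_mem_uIcc
    left_mem_uIcc hana hBnB
  obtain ⟨C₃, hC₃⟩ := exists_quad_of_chart_sub hQp' hAne hBne left_mem_uIcc ha_A left_mem_uIcc
    right_mem_uIcc hnAa hBne
  obtain ⟨C₃r, hC₃r⟩ := exists_quad_of_chart_sub hQp' hAne hBne ha_A left_mem_uIcc right_mem_uIcc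
    left_mem_uIcc hanA hBnB
  -- the perturbation conditions of the four moves (independent of the mesh)
  have hmove₁ : Qmr.IsPerturbationThree C₁r ρ :=
    isPerturbationThree_of_chart hQmr hC₁r hana hbnb hbnB hmB_b' haC hnaC hbC hnbC hρ.le
      (hHθ _ hbB')
  have hmove₂ : C₁.IsPerturbationThree C₂ ρ :=
    isPerturbationThree_of_chart hC₁ hC₂ hane hnBb hBne hB_Bb hnaC haC hnBC hbC hρ.le
      (hHθ _ hbB)
  have hmove₃ : C₃r.IsPerturbationTwo C₂r ρ :=
    isPerturbationTwo_of_chart hC₃r hC₂r hanA hana hBnB hma_aA haC hnAC hBC hnBC hρ.le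
      (hHθ _ hAa)
  have hmove₄ : Qp.IsPerturbationTwo C₃ ρ :=
    isPerturbationTwo_of_chart hQp' hC₃ hAne hnAa hBne ha_A hnAC hAC hnBC hBC hρ.le
      (hHθ _ hAa')
  refine ⟨Qm, Qp, hlt₁, hlt₂, ρ, hρ, fun δ hδ hδρ => ?_⟩
  -- the raw crossing events at mesh `δ`; reversal does not change them
  have hRrev : ∀ {P P' : Quad D} {u₀ u₁ v₀ v₁ : ℝ}, (∀ p, P p = H (rectChart u₀ u₁ v₀ v₁ p)) →
      (∀ p, P' p = H (rectChart u₁ u₀ v₁ v₀ p)) → u₀ ≠ u₁ → v₀ ≠ v₁ →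
      {ω | ∃ K, P'.IsCrossing K ∧ K ⊆ openEdgeUnion δ ω} =
        {ω | ∃ K, P.IsCrossing K ∧ K ⊆ openEdgeUnion δ ω} :=
    fun hP hP' hu hv => by
      ext ω
      simp only [mem_setOf_eq, isCrossing_iff_of_chart_rev hP hP' hu hv]
  have hst := fun {P P' : Quad D} {u₀ u₁ v₀ v₁ : ℝ}
    (hP : ∀ p, P p = H (rectChart u₀ u₁ v₀ v₁ p)) (hv : v₀ ≠ v₁)
    (hv₀ : v₀ ∈ Icc (-2 : ℝ) 2) (hv₁ : v₁ ∈ Icc (-2 : ℝ) 2)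
    (hu : u₀ ∈ Icc (-2 : ℝ) (-1/2) ∧ u₁ ∈ Icc (1/2 : ℝ) 2 ∨
      u₁ ∈ Icc (-2 : ℝ) (-1/2) ∧ u₀ ∈ Icc (1/2 : ℝ) 2)
    (hcond : P.IsPerturbationTwo P' ρ ∨ P.IsPerturbationThree P' ρ) =>
    measureReal_symmDiff_le_of_step hmd hUρ hD hδ hδρ hP hv hv₀ hv₁ hu hcond
  -- the four steps
  have h₁ : (bondPercolation (zdGraph 2) half).real
      (symmDiff {ω | ∃ K, Qm.IsCrossing K ∧ K ⊆ openEdgeUnion δ ω}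
        {ω | ∃ K, C₁.IsCrossing K ∧ K ⊆ openEdgeUnion δ ω}) ≤ ε' := by
    rw [← hRrev hQm' hQmr hane hbne, ← hRrev hC₁ hC₁r hane hnBb]
    exact hst hQmr hbnb hbC hnbC (Or.inr ⟨hnaL, haR⟩) (Or.inr hmove₁)
  have h₂ : (bondPercolation (zdGraph 2) half).real
      (symmDiff {ω | ∃ K, C₁.IsCrossing K ∧ K ⊆ openEdgeUnion δ ω}
        {ω | ∃ K, C₂.IsCrossing K ∧ K ⊆ openEdgeUnion δ ω}) ≤ ε' :=
    hst hC₁ hnBb hnBC hbC (Or.inl ⟨hnaL, haR⟩) (Or.inr hmove₂)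
  have h₃ : (bondPercolation (zdGraph 2) half).real
      (symmDiff {ω | ∃ K, C₂.IsCrossing K ∧ K ⊆ openEdgeUnion δ ω}
        {ω | ∃ K, C₃.IsCrossing K ∧ K ⊆ openEdgeUnion δ ω}) ≤ ε' := by
    rw [← hRrev hC₂ hC₂r hane hBne, ← hRrev hC₃ hC₃r hnAa hBne, symmDiff_comm]
    exact hst hC₃r hBnB hBC hnBC (Or.inr ⟨hnAL, haR⟩) (Or.inl hmove₃)
  have h₄ : (bondPercolation (zdGraph 2) half).real
      (symmDiff {ω | ∃ K, C₃.IsCrossing K ∧ K ⊆ openEdgeUnion δ ω}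
        {ω | ∃ K, Qp.IsCrossing K ∧ K ⊆ openEdgeUnion δ ω}) ≤ ε' := by
    rw [symmDiff_comm]
    exact hst hQp' hBne hnBC hBC (Or.inl ⟨hnAL, hAR⟩) (Or.inl hmove₄)
  -- the chain inclusion and the sum
  have hreal : (bondPercolation (zdGraph 2) half).real
      {ω | (∃ K, Qm.IsCrossing K ∧ K ⊆ openEdgeUnion δ ω) ∧
        ¬ ∃ K, Qp.IsCrossing K ∧ K ⊆ openEdgeUnion δ ω} ≤ 4 * ε' := by
    have := measureReal_diff_le_chain (bondPercolation (zdGraph 2) half)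
      {ω | ∃ K, Qm.IsCrossing K ∧ K ⊆ openEdgeUnion δ ω}
      {ω | ∃ K, C₁.IsCrossing K ∧ K ⊆ openEdgeUnion δ ω}
      {ω | ∃ K, C₂.IsCrossing K ∧ K ⊆ openEdgeUnion δ ω}
      {ω | ∃ K, C₃.IsCrossing K ∧ K ⊆ openEdgeUnion δ ω}
      {ω | ∃ K, Qp.IsCrossing K ∧ K ⊆ openEdgeUnion δ ω}
    have hset : {ω | (∃ K, Qm.IsCrossing K ∧ K ⊆ openEdgeUnion δ ω) ∧
        ¬ ∃ K, Qp.IsCrossing K ∧ K ⊆ openEdgeUnion δ ω} =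
        {ω | ∃ K, Qm.IsCrossing K ∧ K ⊆ openEdgeUnion δ ω} \
          {ω | ∃ K, Qp.IsCrossing K ∧ K ⊆ openEdgeUnion δ ω} := Set.ext fun _ => Iff.rfl
    rw [hset]
    linarith
  calc bondPercolation (zdGraph 2) half
        {ω | (∃ K, Qm.IsCrossing K ∧ K ⊆ openEdgeUnion δ ω) ∧
          ¬ ∃ K, Qp.IsCrossing K ∧ K ⊆ openEdgeUnion δ ω}
      = ENNReal.ofReal ((bondPercolation (zdGraph 2) half).real
          {ω | (∃ K, Qm.IsCrossing K ∧ K ⊆ openEdgeUnion δ ω) ∧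
            ¬ ∃ K, Qp.IsCrossing K ∧ K ⊆ openEdgeUnion δ ω}) := (ofReal_measureReal).symm
    _ ≤ ENNReal.ofReal (4 * ε') := ENNReal.ofReal_le_ofReal hreal
    _ ≤ ε := hε'ε

/-- **The scale-free bound gives uniform continuity**: the hypothesis of
`SchrammSmirnov2011_lemma_6_1_of_bound` (conditions (2), (3)) implies the hypothesis `hU` of
`continuity_of_uniform`, with `ρ₀(m, ε) = min(x₀ m / 2, c m)` where `F < ε` on `(0, x₀)`
(`d(Q) ≥ d₀(Q) ≥ m`, so `ρ ≤ c·d(Q)` and `0 < ρ/d(Q) ≤ x₀/2`). [cite: SchrammSmirnov2011, Lemma 6.1] -/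
theorem uniform_of_bound {c : ℝ} (hc : 0 < c) {F : ℝ → ℝ} (hF : Tendsto F (𝓝[>] 0) (𝓝 0))
    (hb : ∀ (D : Set ℂ) (Q Q' : Quad D) (ρ : ℝ), 0 < ρ → ρ ≤ c * Q.sizeParam →
      (Q.IsPerturbationTwo Q' ρ ∨ Q.IsPerturbationThree Q' ρ) → ∀ η : ℝ, 0 < η → η < ρ →
        (squareCrossingLaw D η : Measure (QuadConfig D)).real
            (symmDiff (QuadConfig.crossedEvent Q) (QuadConfig.crossedEvent Q')) ≤
          F (ρ / Q.sizeParam))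
    (m : ℝ) (hm : 0 < m) (ε : ℝ) (hε : 0 < ε) :
    ∃ ρ₀ : ℝ, 0 < ρ₀ ∧ ∀ ρ : ℝ, 0 < ρ → ρ ≤ ρ₀ →
      ∀ (D : Set ℂ) (Q Q' : Quad D), m ≤ Q.sideDist 0 →
        (Q.IsPerturbationTwo Q' ρ ∨ Q.IsPerturbationThree Q' ρ) → ∀ η : ℝ, 0 < η → η < ρ →
          (squareCrossingLaw D η : Measure (QuadConfig D)).real
              (symmDiff (QuadConfig.crossedEvent Q) (QuadConfig.crossedEvent Q')) ≤ ε := by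
  -- `F < ε` on `(0, x₀)`
  obtain ⟨x₀, hx₀, hFx⟩ : ∃ x₀ : ℝ, 0 < x₀ ∧ ∀ x : ℝ, 0 < x → x < x₀ → F x < ε := by
    have hev : ∀ᶠ x in 𝓝[>] (0 : ℝ), dist (F x) 0 < ε := Metric.tendsto_nhds.1 hF ε hε
    rw [eventually_nhdsWithin_iff, Metric.eventually_nhds_iff] at hev
    obtain ⟨r, hr, h⟩ := hev
    refine ⟨r, hr, fun x hx hxr => ?_⟩
    have := h (by rwa [Real.dist_0_eq_abs, abs_of_pos hx]) hx
    rw [Real.dist_0_eq_abs] at this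
    exact (le_abs_self _).trans_lt this
  refine ⟨min (x₀ * m / 2) (c * m), lt_min (by positivity) (by positivity),
    fun ρ hρ hρ₀ D Q Q' hmQ hcond η hη hηρ => ?_⟩
  have hρx : ρ ≤ x₀ * m / 2 := hρ₀.trans (min_le_left _ _)
  have hρc : ρ ≤ c * m := hρ₀.trans (min_le_right _ _)
  have hmd : m ≤ Q.sizeParam := hmQ.trans Q.sideDist_zero_le_sizeParam
  have hd : 0 < Q.sizeParam := hm.trans_le hmd
  have hρd : ρ ≤ c * Q.sizeParam := hρc.trans (mul_le_mul_of_nonneg_left hmd hc.le)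
  refine (hb D Q Q' ρ hρ hρd hcond η hη hηρ).trans (hFx _ (div_pos hρ hd) ?_).le
  calc ρ / Q.sizeParam ≤ ρ / m := div_le_div_of_nonneg_left hρ.le hm hmd
    _ ≤ (x₀ * m / 2) / m := div_le_div_of_nonneg_right hρx hm.le
    _ = x₀ / 2 := by field_simp
    _ < x₀ := by linarith

/-- **Schramm–Smirnov's (5.1) for critical bond percolation on `δℤ²`, from the scale-free form of
their Lemma 6.1 (conditions (2), (3)).**  Hypothesis: for some `c > 0` and `F → 0` at `0⁺`,
`μ_η(⊞_Q Δ ⊞_{Q'}) ≤ F(ρ / d(Q))` for all `D`, all quads `Q, Q'` of `D`, all `0 < ρ ≤ c·d(Q)` with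
`Q.IsPerturbationTwo Q' ρ` or `Q.IsPerturbationThree Q' ρ`, and all `0 < η < ρ` (the hypothesis of
`SchrammSmirnov2011_lemma_6_1_of_bound`, minus condition (1)).  Conclusion, for `D` open,
`Q₀ ∈ 𝒬_D` and `ε > 0`: there are quads `Q' < Q₀ < Q''` of `D` (the perturbations
`Q^{q_{∓s}}` of `Quad.exists_perturbations`) and `δ₀ > 0` such that for every mesh `0 < δ < δ₀`,
`P_{1/2}[Q' has a crossing inside the open edges of δℤ² and Q'' has none] ≤ ε`.  Proof: `continuity_of_uniform` and `uniform_of_bound` (the chain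
`Q' = [-a,a]×[-b,b] → [-a,a]×[-B,b] → [-a,a]×[-B,B] → [-A,a]×[-B,B] → [-A,A]×[-B,B] = Q''`
(`a = 1-s`, `A = 1/(1-s)`, `b = 1+s`, `B = 1/(1+s)`, in the straightening chart `H`) of four
one-coordinate moves, each an instance of condition (3) or (2) for the pair or the reversed pair;
the size parameters of the four larger quads are `≥ m(H)` (`exists_pos_le_sizeParam_of_chart`), so
`ρ := min(x₀(ε), c)·m/2` works for all of them once `s` is small enough (uniform continuity of `H`
on `[-2,2]²`) to make the moves `ρ`-short; the four bounds `< ε/4` add up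
(`measureReal_diff_le_chain`, `measureReal_symmDiff_setOf_exists_isCrossing`)).
[cite: SchrammSmirnov2011, Lemma 5.1 (proof, §5 p. 21, eq. (5.1)); Lemma 6.1] -/
theorem continuity_of_bound {c : ℝ} (hc : 0 < c) {F : ℝ → ℝ} (hF : Tendsto F (𝓝[>] 0) (𝓝 0))
    (hb : ∀ (D : Set ℂ) (Q Q' : Quad D) (ρ : ℝ), 0 < ρ → ρ ≤ c * Q.sizeParam →
      (Q.IsPerturbationTwo Q' ρ ∨ Q.IsPerturbationThree Q' ρ) → ∀ η : ℝ, 0 < η → η < ρ →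
        (squareCrossingLaw D η : Measure (QuadConfig D)).real
            (symmDiff (QuadConfig.crossedEvent Q) (QuadConfig.crossedEvent Q')) ≤
          F (ρ / Q.sizeParam))
    (hD : IsOpen D) (Q₀ : Quad D) (ε : ℝ≥0∞) (hε : 0 < ε) :
    ∃ Q' Q'' : Quad D, StrictlyDominated Q' Q₀ ∧ StrictlyDominated Q₀ Q'' ∧
      ∃ δ₀ : ℝ, 0 < δ₀ ∧ ∀ δ : ℝ, 0 < δ → δ < δ₀ →
        bondPercolation (zdGraph 2) half
          {ω | (∃ K, Q'.IsCrossing K ∧ K ⊆ openEdgeUnion δ ω) ∧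
            ¬ ∃ K, Q''.IsCrossing K ∧ K ⊆ openEdgeUnion δ ω} ≤ ε :=
  continuity_of_uniform (uniform_of_bound hc hF hb) hD Q₀ ε hε

/-- `Quad.continuity_of_bound` with the verbatim (three-condition) hypothesis of
`SchrammSmirnov2011_lemma_6_1_of_bound`. [cite: SchrammSmirnov2011, Lemma 5.1 (proof, eq. (5.1)); Lemma 6.1] -/
theorem continuity_of_bound' {c : ℝ} (hc : 0 < c) {F : ℝ → ℝ} (hF : Tendsto F (𝓝[>] 0) (𝓝 0))
    (hbound : ∀ (D : Set ℂ) (Q Q' : Quad D) (δ : ℝ), 0 < δ → δ ≤ c * Q.sizeParam →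
      (Q.IsPerturbationOne Q' δ ∨ Q.IsPerturbationTwo Q' δ ∨ Q.IsPerturbationThree Q' δ) →
        ∀ η : ℝ, 0 < η → η < δ →
          (squareCrossingLaw D η : Measure (QuadConfig D)).real
              (symmDiff (QuadConfig.crossedEvent Q) (QuadConfig.crossedEvent Q')) ≤
            F (δ / Q.sizeParam))
    (hD : IsOpen D) (Q₀ : Quad D) (ε : ℝ≥0∞) (hε : 0 < ε) :
    ∃ Q' Q'' : Quad D, StrictlyDominated Q' Q₀ ∧ StrictlyDominated Q₀ Q'' ∧
      ∃ δ₀ : ℝ, 0 < δ₀ ∧ ∀ δ : ℝ, 0 < δ → δ < δ₀ →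
        bondPercolation (zdGraph 2) half
          {ω | (∃ K, Q'.IsCrossing K ∧ K ⊆ openEdgeUnion δ ω) ∧
            ¬ ∃ K, Q''.IsCrossing K ∧ K ⊆ openEdgeUnion δ ω} ≤ ε :=
  continuity_of_bound hc hF (fun D Q Q' ρ hρ hρd h => hbound D Q Q' ρ hρ hρd (Or.inr h)) hD Q₀ ε hε

end Quad

/-! ### Lemma 5.1 from the scale-free bound -/

/-- **Schramm–Smirnov's Lemma 5.1 from uniform continuity of the crossing events under conditions
(2), (3) of Lemma 6.1** (the hypothesis `hU` of `Quad.continuity_of_uniform`), through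
`SchrammSmirnov2011_lemma_5_1_of_continuity`. [cite: SchrammSmirnov2011, Lemma 5.1 (proof, §5 p. 21); Lemma 6.1] -/
theorem SchrammSmirnov2011_lemma_5_1_of_uniform
    (hU : ∀ m : ℝ, 0 < m → ∀ ε : ℝ, 0 < ε → ∃ ρ₀ : ℝ, 0 < ρ₀ ∧ ∀ ρ : ℝ, 0 < ρ → ρ ≤ ρ₀ →
      ∀ (D : Set ℂ) (Q Q' : Quad D), m ≤ Q.sideDist 0 →
        (Q.IsPerturbationTwo Q' ρ ∨ Q.IsPerturbationThree Q' ρ) → ∀ η : ℝ, 0 < η → η < ρ →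
          (squareCrossingLaw D η : Measure (QuadConfig D)).real
              (symmDiff (QuadConfig.crossedEvent Q) (QuadConfig.crossedEvent Q')) ≤ ε) :
    SchrammSmirnov2011_lemma_5_1 :=
  SchrammSmirnov2011_lemma_5_1_of_continuity fun _ hD _ Q₀ ε hε =>
    Quad.continuity_of_uniform hU hD Q₀ ε hε

/-- **Schramm–Smirnov's Lemma 5.1 (`μ(∂⊞_{Q₀}) = 0` for every subsequential scaling limit of
critical bond percolation on `δℤ²`, every open `D` and every `Q₀ ∈ 𝒬_D`) from the scale-free form
of their Lemma 6.1, conditions (2) and (3)**: `Quad.continuity_of_bound` feeds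
`SchrammSmirnov2011_lemma_5_1_of_continuity`.  This closes the named fact
`SchrammSmirnov2011_lemma_5_1` modulo exactly the estimate that the Lemma 6.1 proofs files
establish for `SchrammSmirnov2011_lemma_6_1_of_bound`.
[cite: SchrammSmirnov2011, Lemma 5.1 (proof, §5 p. 21); Lemma 6.1] -/
theorem SchrammSmirnov2011_lemma_5_1_of_bound {c : ℝ} (hc : 0 < c) {F : ℝ → ℝ}
    (hF : Tendsto F (𝓝[>] 0) (𝓝 0))
    (hb : ∀ (D : Set ℂ) (Q Q' : Quad D) (ρ : ℝ), 0 < ρ → ρ ≤ c * Q.sizeParam →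
      (Q.IsPerturbationTwo Q' ρ ∨ Q.IsPerturbationThree Q' ρ) → ∀ η : ℝ, 0 < η → η < ρ →
        (squareCrossingLaw D η : Measure (QuadConfig D)).real
            (symmDiff (QuadConfig.crossedEvent Q) (QuadConfig.crossedEvent Q')) ≤
          F (ρ / Q.sizeParam)) :
    SchrammSmirnov2011_lemma_5_1 :=
  SchrammSmirnov2011_lemma_5_1_of_continuity fun _ hD _ Q₀ ε hε =>
    Quad.continuity_of_bound hc hF hb hD Q₀ ε hε

/-- `SchrammSmirnov2011_lemma_5_1_of_bound` with the verbatim (three-condition) hypothesis of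
`SchrammSmirnov2011_lemma_6_1_of_bound`: **the bound that gives Lemma 6.1 also gives Lemma 5.1.**
[cite: SchrammSmirnov2011, Lemma 5.1; Lemma 6.1] -/
theorem SchrammSmirnov2011_lemma_5_1_of_bound' {c : ℝ} (hc : 0 < c) (F : ℝ → ℝ)
    (hF : Tendsto F (𝓝[>] 0) (𝓝 0))
    (hbound : ∀ (D : Set ℂ) (Q Q' : Quad D) (δ : ℝ), 0 < δ → δ ≤ c * Q.sizeParam →
      (Q.IsPerturbationOne Q' δ ∨ Q.IsPerturbationTwo Q' δ ∨ Q.IsPerturbationThree Q' δ) →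
        ∀ η : ℝ, 0 < η → η < δ →
          (squareCrossingLaw D η : Measure (QuadConfig D)).real
              (symmDiff (QuadConfig.crossedEvent Q) (QuadConfig.crossedEvent Q')) ≤
            F (δ / Q.sizeParam)) :
    SchrammSmirnov2011_lemma_5_1 :=
  SchrammSmirnov2011_lemma_5_1_of_bound hc hF fun D Q Q' ρ hρ hρd h =>
    hbound D Q Q' ρ hρ hρd (Or.inr h)

end QuadCrossing

end Literature.Probability.Percolation

end
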